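/-
Copyright (c) 2026 the pub-hodgecm-mathlib formalisation cell (harness21).  Prover seat hodgecm-mathlib-LH7-p06 (g3), req620 Track A «(D-RAM) FOUR-FRAME» squad
(STAGE-1b, row (2) of the piece `f_{T₊}`, the (β₂) road (R-36); β₂ sub-dealer LH4-p04 (g10) WORD #30 «LH7-p06: K6-(b) (hI) CLASS PART» — the generator-independence
hypothesis (hI) of LH4-p19 (g2)'s three-way count socket ★ p863833, in LH4-p16 (g2)'s ROW currency of ★ p863914), 2026-09-05.
-/
import Summits.HodgeConjecture.HodgeConjecture.Theorems.F0P3cDyRamRowCellSocketReads                 -- ★ p863914 (LH4-p16 (g2)): the ROW currency `CLS`, `Vf` and the socket-shape (hV)(hP); brings ★ p863477 `trace_letters`, ★ DEFS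
import Summits.HodgeConjecture.HodgeConjecture.Theorems.F0P3cDyRamDiagonalCellGeneratorIndependence   -- ★ p863081 (LH4-p19 (g2)): the DIAGONAL twin; `v_eq_one_of_isOrd_of_mul_eq_one`, `v_le_pow_two_mul_of_fixed`; brings ★ p862877 `exists_isOrd_mul_of_presentations`, ★ T4 `mem_order_iff_exists`, ★ `v_add_map_le_varpi_pow_mstar_of_datum`
import Summits.HodgeConjecture.HodgeConjecture.Theorems.F0P3cDyRamRowVertexCoordinateChange           -- ★ p863222 (LH4-p16 (g2)): `div_trace_mul_sub_div_trace` (the exact change of `w∕Tr_ρ w`), `v_normTheta_sub_map_le`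
import Summits.HodgeConjecture.HodgeConjecture.Theorems.F0P3cDyRamDiagonalCellCleanRegime              -- ★ (LH4 lineage): `v_map_le_pow_iff` (`|jE c| ≤ |jEϖ|^n ↔ |c| ≤ |ϖ|^n`)
import HarnessLib

/-!
# Crux `H413`, line LH4 «(D-RAM) FOUR-FRAME» — STAGE-1b, row (2), the (β₂) road (R-36), K6-(b): «THE CLASS OF `t` AND THE DIGIT OF `κ̂` OF A ROW CELL MEMBER DO NOT
# DEPEND ON THE GENERATOR» — the (hI) hypothesis of ★ `…ConeCellCountSocketThree.cellDiff_eq_zero_of_fibration_reads₃` in the ROW currency, in the socket's binder shape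

Cell `hodgecm-mathlib` (D-0151), FLOOR 0, crux item H413 = `stmt-HodgeConjecture-24833`, route of record `HCCMUnconditional`; squad F0∕P3c∕LH4 (hand LH7-p06); lane
`--supports stmt-HodgeConjecture-24833 --as helper` (count-neutral; pays NO tier-0 row).  THEOREMS ONLY (no `def`, no instance, no notation, no `sorry`, default heartbeats);
★-only imports; states NO law; (β₂) stays a HYPOTHESIS.  Frame = ★ p863914's (`E`-side wild datum `IsRamifiedQuadraticDatum σ ϖ d tE`, `jE : E → M` with `Fix ρ = jE(E)`,
`Θ∘jE = jE∘σ`; `ρ, Θ` commuting involutive isometries of `M`; integral power basis `α` (`hα hα1 hint`); ★ DEFS `IsOrd ∕ dualGen`); the cell `(j, b)` with `1 ≤ b`, `d ≤ b`,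
`b ≤ j` (towers and the diagonal); the «deep doubly-fixed units are norms» letter `hdeep` of ★ p863081 at `M`-depth `|jEϖ|^{2d}` is a BINDER.

WHY (β₂ WORD #30; LH4-p16 (g2) `CELLREAD-C.sig.v2` row (hI); ★ p863914 «WHAT IS NOT CLAIMED: (hI)»).  The socket fibres a cell by `Λ ↦ (CLS, digit of Vf)` read off a generator
`x₀` of `Λ = x₀·𝒪_j`; in the ROW currency `CLS x₀ :≡ (t(x₀) ∈ 𝒩)`, `t = Tr_ρ(u₀)`, `u₀ = h·x₀Θx₀`, `𝒩 = {eΘe : ρe = e}`, `Vf x₀ :≡ (ρu₀∕t − κ₀)∕ξ₀` (★ p863914 §1∕§2); (hI) says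
both are the LATTICE's.  A second generator is `x₀′ = x₀·z`, `z` a unit of the order (★ `exists_isOrd_mul_of_presentations`), `z = a + cc·y`, `ρa = a`, `|a| = 1` (★ T4; `cc = jEϖ^j`,
`1 ≤ b ≤ j`); `t′ = Tr_ρ(u₀·zΘz) = aΘa·t + (e₁ + Θe₁) + Tr_ρ(u₀·N_Θ(cc y))`, `e₁ = Tr_ρ(u₀·Θa·cc y) ∈ Fix ρ` (§1).  SIZES (§2) use the order bound on `Y = dualGen = u₀·cc·(α − ρα)`:
`ρ(α − ρα) = −(α − ρα)` ⇒ `Tr_ρ(X∕(α − ρα)) = (X − ρX)∕(α − ρα)`, and `|Y − ρY| ≤ |cc(α − ρα)|` + `hint` absorb the `1∕|α − ρα|` of `u₀` (NO `|α − ρα| = 1`, NO `hjiso`: lane-agnostic):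
`|e₁| ≤ |jEϖ|^b`, `|Tr_ρ(u₀N_Θ(ccy))| ≤ |jEϖ|^{j+b} ≤ |jEϖ|^{2d}`.  TRACE GAIN (§3) on `E` through `jE` (★ `v_add_map_le_varpi_pow_mstar_of_datum` on the `σ`-datum + parity
★ `v_le_pow_two_mul_of_fixed`): `|e₁ + Θe₁| ≤ |jEϖ|^{2d}`.  So `t′ = aΘa·t·u`, `u` doubly fixed, `|u − 1| ≤ |jEϖ|^{2d}`; `hdeep` ⇒ `t′ = t·N_Θ(a·c₀)` (§4).  DIGIT (§5): `κ̂ = ρu₀∕t` moves by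
the skew of `N = zΘz` (★ `div_trace_mul_sub_div_trace`): `|κ̂′ − κ̂| = |u₀|²·|N − ρN| ≤ |u₀|²·|cc(α − ρα)| ≤ |Y|·|ξ₀|` under ★ p863914 §1's letter `hR`, i.e. `|Vf x₀′ − Vf x₀| ≤ |jEϖ|^b`.
* §1 algebra: `normTheta_gen_mul`, `trace_normTheta_add_decomp`, `exists_fixed_normTheta_iff_of_eq_mul` (class transport by a `ρ`-fixed `Θ`-norm);
* §2 sizes: `div_add_map_div_of_anti`, `v_sub_map_mul_le`, `digit_mul_sub_digit` (★ `div_trace_mul_sub_div_trace` in `ρu₀∕Tr_ρ u₀` form);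
* §3 the trace gain through `jE` (★ `v_map_le_pow_iff`): `v_add_map_le_pow_two_mul_of_fixed`;
* §4 CLASS PART `cls_iff_cls_of_gen`; §5 DIGIT PART `v_coord_sub_coord_le_of_gen`; §6 HEAD `cls_iff_cls_and_v_sub_le_of_gen` = (hI) of ★ p863833 at ★ p863914's `CLS ∕ Vf`.
WHAT IS NOT CLAIMED: (hLit), (hF), (hbase), the `hdeep` letter itself (the `E∕F` norm theorem at depth `d`), any count.
HONEST LABEL.  Count-neutral field ∕ valuation algebra; nothing printed is asserted; no census law is stated; `HC_CM` is proved only modulo the 7 printed citations (2 remaining named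
inputs: hLiu418 = `stmt-HodgeConjecture-24832`, h413 = `stmt-HodgeConjecture-24833`) until rung 0 closes.
## References
* [Serre1979] J.-P. Serre, *Local Fields*, GTM 67 (1979): Ch. III §6 Prop. 12 (orders `𝒪_E + c𝒪_M`), Ch. III §3 Prop. 7 (trace ideals), Ch. V §3 Prop. 5 & Cor. 2–3 (norms near 1).
* [Jacobowitz1962] R. Jacobowitz, *Hermitian forms over local fields*, Amer. J. Math. 84 (1962): §4 (dual lattices, gluing).
* [Kottwitz1986BaseChangeUnits] R. E. Kottwitz, *Base change for unit elements of Hecke algebras*, Compositio Math. 60 (1986): §1 pp. 240–241 (fixed-lattice counts).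
* [Flicker1998UnitaryFL] Y. Z. Flicker, *Elementary proof of the fundamental lemma for a unitary group*, Canad. J. Math. 50 (1998): p. 84 REMARK (Mars' orders `R + π^jR_E`).
-/

set_option autoImplicit false

noncomputable section

namespace Summit.HodgeConjecture.HodgeConjecture.Cruxes.H413.F0P3cDyRamRowCellGeneratorIndependence

open scoped Valued WithZero
open WithZero
open Literature.NumberTheory.Automorphic.UnitaryThreeFourFrame (IsRamifiedQuadraticDatum)
open Literature.NumberTheory.LocalFields.QuadraticOrder (mem_order_iff_exists)
open Summit.HodgeConjecture.HodgeConjecture.Cruxes.H413.F0P3cDyRamToricCensusDefs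
open Summit.HodgeConjecture.HodgeConjecture.Cruxes.H413.F0P3cDyRamFourFramePieces (mstarOfRecord)
open Summit.HodgeConjecture.HodgeConjecture.Cruxes.H413.F0P3cDyRamDiagonalCellLetter (v_add_map_le_of_le v_add_map_le_varpi_pow_mstar_of_datum)
open Summit.HodgeConjecture.HodgeConjecture.Cruxes.H413.F0P3cDyRamDiagonalCellGeneratorChange (exists_isOrd_mul_of_presentations)
open Summit.HodgeConjecture.HodgeConjecture.Cruxes.H413.F0P3cDyRamDiagonalCellGeneratorIndependence (v_eq_one_of_isOrd_of_mul_eq_one v_le_pow_two_mul_of_fixed)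
open Summit.HodgeConjecture.HodgeConjecture.Cruxes.H413.F0P3cDyRamRowVertexCoordinateChange (div_trace_mul_sub_div_trace v_normTheta_sub_map_le)
open Summit.HodgeConjecture.HodgeConjecture.Cruxes.H413.F0P3cDyRamRowCellFibreTransport (trace_letters)
open Summit.HodgeConjecture.HodgeConjecture.Cruxes.H413.F0P3cDyRamDiagonalCellCleanRegime (v_map_le_pow_iff)

variable {E M : Type} [Field E] [Valued E ℤᵐ⁰] [Field M] [Valued M ℤᵐ⁰] {ρ Θ : M →+* M} {α : M}

/-! ## §1 Algebra: the population scalar of `x₀·z`, `z = a + w` -/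
omit [Valued M ℤᵐ⁰] in
/-- **`u₀(x₀·z) = u₀(x₀)·zΘz`** (`u₀(x) = h·xΘx`). [cite: Jacobowitz1962, §4] -/
theorem normTheta_gen_mul (hM x₀ z : M) : hM * (x₀ * z * Θ (x₀ * z)) = hM * (x₀ * Θ x₀) * (z * Θ z) := by
  rw [map_mul]; ring

omit [Valued M ℤᵐ⁰] in
/-- **THE DECOMPOSITION OF `t′ = Tr_ρ(u₀·zΘz)` FOR `z = a + w`, `ρa = a`, `Θu₀ = u₀`**:
`Tr_ρ(u₀·(a + w)Θ(a + w)) = aΘa·Tr_ρ u₀ + (e₁ + Θe₁) + Tr_ρ(u₀·wΘw)`, `e₁ = Tr_ρ(u₀·Θa·w)` (`Θρ = ρΘ`, `Θ² = 1`). [cite: Serre1979, Ch. III §3 Prop. 7] [cite: Jacobowitz1962, §4] -/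
theorem trace_normTheta_add_decomp (hΘΘ : ∀ x, Θ (Θ x) = x) (hΘρ : ∀ x, Θ (ρ x) = ρ (Θ x)) {u₀ a w : M} (hΘu : Θ u₀ = u₀) (hρa : ρ a = a) :
    u₀ * ((a + w) * Θ (a + w)) + ρ (u₀ * ((a + w) * Θ (a + w))) =
      a * Θ a * (u₀ + ρ u₀) + ((u₀ * Θ a * w + ρ (u₀ * Θ a * w)) + Θ (u₀ * Θ a * w + ρ (u₀ * Θ a * w))) +
        (u₀ * (w * Θ w) + ρ (u₀ * (w * Θ w))) := by
  have hρΘa : ρ (Θ a) = Θ a := by rw [← hΘρ, hρa]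
  have hΘρu : Θ (ρ u₀) = ρ u₀ := by rw [hΘρ, hΘu]
  simp only [map_add, map_mul, hΘΘ, hΘu, hρa, hρΘa, hΘρu, hΘρ]
  ring

omit [Valued M ℤᵐ⁰] in
/-- **CLASS TRANSPORT BY A `ρ`-FIXED `Θ`-NORM**: `t′ = t·cΘc` with `ρc = c`, `c ≠ 0` ⟹ (`t = eΘe`, `ρe = e` for some `e`) ⟺ (the same for `t′`). [cite: Serre1979, Ch. V §3 Cor. 3] -/
theorem exists_fixed_normTheta_iff_of_eq_mul {t t' c : M} (hρc : ρ c = c) (hc : c ≠ 0) (ht' : t' = t * (c * Θ c)) :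
    (∃ e : M, ρ e = e ∧ e * Θ e = t) ↔ (∃ e : M, ρ e = e ∧ e * Θ e = t') := by
  have hΘc : Θ c ≠ 0 := (map_ne_zero Θ).2 hc
  have hcc : c * Θ c ≠ 0 := mul_ne_zero hc hΘc
  constructor
  · rintro ⟨e, hρe, he⟩
    exact ⟨e * c, by rw [map_mul, hρe, hρc], by rw [ht', ← he, map_mul]; ring⟩
  · rintro ⟨e, hρe, he⟩
    refine ⟨e / c, by rw [map_div₀, hρe, hρc], ?_⟩
    have h1 : t = t' / (c * Θ c) := by rw [ht', mul_div_cancel_right₀ _ hcc]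
    rw [h1, ← he, map_div₀]
    field_simp

/-! ## §2 Sizes: the `1∕|α − ρα|` of `u₀ = Y∕(cc(α − ρα))` is absorbed by the order bound on `Y` -/
omit [Valued M ℤᵐ⁰] in
/-- **`Tr_ρ(X∕A) = (X − ρX)∕A` FOR `ρA = −A`.** [cite: Serre1979, Ch. III §6 Prop. 12] -/
theorem div_add_map_div_of_anti {X A : M} (hA : ρ A = -A) : X / A + ρ (X / A) = (X - ρ X) / A := by
  rw [map_div₀, hA, div_neg, sub_div, sub_eq_add_neg]

/-- `Y·m − ρ(Y·m) = (Y − ρY)·m + ρY·(m − ρm)`, hence `|Y·m − ρ(Y·m)| ≤ C` once `|Y − ρY|·|m| ≤ C` and `|Y|·|m − ρm| ≤ C` (`ρ` isometric). [cite: Serre1979, Ch. III §6 Prop. 12] -/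
theorem v_sub_map_mul_le (hvρ : ∀ x, Valued.v (ρ x) = Valued.v x) (Y m : M) {C : ℤᵐ⁰}
    (h1 : Valued.v (Y - ρ Y) * Valued.v m ≤ C) (h2 : Valued.v Y * Valued.v (m - ρ m) ≤ C) : Valued.v (Y * m - ρ (Y * m)) ≤ C := by
  have e : Y * m - ρ (Y * m) = (Y - ρ Y) * m + ρ Y * (m - ρ m) := by rw [map_mul]; ring
  rw [e]
  refine (Valuation.map_add _ _ _).trans (max_le ?_ ?_)
  · rwa [Valuation.map_mul]
  · rwa [Valuation.map_mul, hvρ]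

omit [Valued M ℤᵐ⁰] in
/-- **THE EXACT CHANGE OF THE DIGIT `κ̂ = ρu₀∕Tr_ρ u₀` UNDER `u₀ ↦ u₀·N`**: `ρ(u₀N)∕Tr_ρ(u₀N) − ρu₀∕Tr_ρ u₀ = u₀·ρu₀·(ρN − N)∕(Tr_ρ u₀·Tr_ρ(u₀N))` (both traces
non-zero) — ★ `div_trace_mul_sub_div_trace` at `w = ρu₀`, `u = ρN`: the digit moves by the SKEW of `N`. [cite: Serre1979, Ch. III §3 Prop. 7] [cite: Jacobowitz1962, §4] -/
theorem digit_mul_sub_digit (hρρ : ∀ x, ρ (ρ x) = x) {u₀ N : M} (hT : u₀ + ρ u₀ ≠ 0) (hT' : u₀ * N + ρ (u₀ * N) ≠ 0) :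
    ρ (u₀ * N) / (u₀ * N + ρ (u₀ * N)) - ρ u₀ / (u₀ + ρ u₀) = u₀ * ρ u₀ * (ρ N - N) / ((u₀ + ρ u₀) * (u₀ * N + ρ (u₀ * N))) := by
  have hT₁ : ρ u₀ + ρ (ρ u₀) ≠ 0 := by rwa [hρρ, add_comm]
  have hT₁' : ρ u₀ * ρ N + ρ (ρ u₀ * ρ N) ≠ 0 := by rwa [← map_mul, hρρ, add_comm]
  have key := div_trace_mul_sub_div_trace (ρ := ρ) hT₁ hT₁'
  rw [← map_mul, hρρ, hρρ, hρρ, add_comm (ρ u₀) u₀, add_comm (ρ (u₀ * N)) (u₀ * N)] at key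
  rw [key]; ring

/-! ## §3 The trace gain, taken on `E` through `jE` -/
/-- **THE TRACE GAIN THROUGH `jE`**: for the wild datum `IsRamifiedQuadraticDatum σ ϖ d tE` on `E`, `Fix ρ = jE(E)`, `Θ∘jE = jE∘σ`, the unit-ball letter `hjv`, and `d ≤ b`:
a `ρ`-FIXED `e` with `|e| ≤ |jEϖ|^b` has `|e + Θe| ≤ |jEϖ|^{2d}` (`e = jE e′`, `|e′| ≤ |ϖ|^b`, ★ `v_add_map_le_varpi_pow_mstar_of_datum` gives `|e′ + σe′| ≤ |ϖ|^{m*}`,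
parity ★ `v_le_pow_two_mul_of_fixed` gives `|ϖ|^{2d}`). [cite: Serre1979, Ch. III §3 Prop. 7; Ch. V §3 Prop. 5, Cor. 2–3] -/
theorem v_add_map_le_pow_two_mul_of_fixed {σ : E →+* E} {ϖ : E} {d tE : ℕ} (hD : IsRamifiedQuadraticDatum σ ϖ d tE)
    (jE : E →+* M) (hjv : ∀ c, Valued.v (jE c) ≤ 1 ↔ Valued.v c ≤ 1) (hjfix : ∀ z, ρ z = z ↔ ∃ c, jE c = z) (hΘj : ∀ c, Θ (jE c) = jE (σ c))
    {b : ℕ} (hdb : d ≤ b) {e : M} (hρe : ρ e = e) (he : Valued.v e ≤ Valued.v (jE ϖ) ^ b) :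
    Valued.v (e + Θ e) ≤ Valued.v (jE ϖ) ^ (2 * d) := by
  have hσσ := hD.1
  have hϖ : Valued.v ϖ = exp (-1 : ℤ) := hD.2.2.1
  have hvϖ0 : Valued.v ϖ ≠ 0 := by rw [hϖ]; exact exp_ne_zero
  have hϖ0 : ϖ ≠ 0 := fun h0 => by rw [h0, map_zero] at hvϖ0; exact hvϖ0 rfl
  obtain ⟨e', rfl⟩ := (hjfix e).1 hρe
  have he' : Valued.v e' ≤ Valued.v ϖ ^ b := (v_map_le_pow_iff jE hjv hϖ0 e' b).1 he
  have h1 : Valued.v (e' + σ e') ≤ Valued.v ϖ ^ mstarOfRecord d := v_add_map_le_varpi_pow_mstar_of_datum hD hdb he'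
  have hσfix : σ (e' + σ e') = e' + σ e' := by rw [map_add, hσσ, add_comm]
  have h2 : Valued.v (e' + σ e') ≤ Valued.v ϖ ^ (2 * d) := v_le_pow_two_mul_of_fixed hD hσfix h1
  rw [hΘj, ← map_add]
  exact (v_map_le_pow_iff jE hjv hϖ0 (e' + σ e') (2 * d)).2 h2

/-! ## §4 THE CLASS PART of (hI): the `E∕F`-class of `t(x₀)` is the lattice's -/
/-- **(hI), CLASS PART — «THE CLASS OF THE POPULATION SCALAR DOES NOT DEPEND ON THE GENERATOR».**  Frame of ★ p863914 (`E`-side wild datum, `jE`-letters `hjv hjfix hΘj`,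
`ρ, Θ` commuting involutive isometries, the integral power basis `hα hα1 hint`, `Θh = h`, the cell `(j, b)` with `1 ≤ b`, `d ≤ b`, `b ≤ j`, `cc(α − ρα) ≠ 0`, the gap letter
`hFgap`) + the letter `hdeep` («a doubly-fixed `u` with `|u − 1| ≤ |jEϖ|^{2d}` is `cΘc` with `ρc = c`»); two generators `x₀, x₀′` of ONE `Λ` each with the five `GEN` clauses of
the socket VERBATIM.  THEN `(∃ e, ρe = e ∧ eΘe = t(x₀)) ↔ (∃ e, ρe = e ∧ eΘe = t(x₀′))`, `t(x) = h·xΘx + ρ(h·xΘx)` — the socket's `CLS x₀ ↔ CLS x₀′` at ★ p863914's `CLS`.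
[cite: Serre1979, Ch. III §6 Prop. 12; Ch. V §3 Cor. 3] [cite: Kottwitz1986BaseChangeUnits, §1 pp. 240–241] [cite: Flicker1998UnitaryFL, p. 84 REMARK] -/
theorem cls_iff_cls_of_gen {σ : E →+* E} {ϖ : E} {d tE : ℕ} (hD : IsRamifiedQuadraticDatum σ ϖ d tE)
    (jE : E →+* M) (hjv : ∀ c, Valued.v (jE c) ≤ 1 ↔ Valued.v c ≤ 1) (hjfix : ∀ z, ρ z = z ↔ ∃ c, jE c = z) (hΘj : ∀ c, Θ (jE c) = jE (σ c))
    (hρρ : ∀ x, ρ (ρ x) = x) (hvρ : ∀ x, Valued.v (ρ x) = Valued.v x) (hΘΘ : ∀ x, Θ (Θ x) = x) (hΘρ : ∀ x, Θ (ρ x) = ρ (Θ x))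
    (hvΘ : ∀ x, Valued.v (Θ x) = Valued.v x)
    (hα : ρ α ≠ α) (hα1 : Valued.v α ≤ 1) (hint : ∀ z : M, Valued.v z ≤ 1 → Valued.v ((z - ρ z) / (α - ρ α)) ≤ 1)
    {hM : M} (hΘh : Θ hM = hM) {j b : ℕ} (hb1 : 1 ≤ b) (hdb : d ≤ b) (hbj : b ≤ j) (hcc : jE ϖ ^ j * (α - ρ α) ≠ 0)
    (hFgap : ∀ z : M, ρ z = z → Θ z = z → Valued.v (jE ϖ) < Valued.v z → Valued.v z ≤ 1 → Valued.v z = 1)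
    (hdeep : ∀ u : M, ρ u = u → Θ u = u → Valued.v (u - 1) ≤ Valued.v (jE ϖ) ^ (2 * d) → ∃ c : M, ρ c = c ∧ c * Θ c = u)
    (Λ : AddSubgroup M) (x₀ x₀' : M)
    (hG : x₀ ≠ 0 ∧ (∀ x, x ∈ Λ ↔ ∃ ζ, IsOrd ρ α (jE ϖ ^ j) ζ ∧ x = x₀ * ζ) ∧
      IsOrd ρ α (jE ϖ ^ j) (dualGen ρ Θ α (jE ϖ ^ j) hM x₀) ∧ ¬ IsOrd ρ α (jE ϖ ^ j) (dualGen ρ Θ α (jE ϖ ^ j) hM x₀ / jE ϖ) ∧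
      Valued.v (dualGen ρ Θ α (jE ϖ ^ j) hM x₀) = Valued.v (jE ϖ) ^ b)
    (hG' : x₀' ≠ 0 ∧ (∀ x, x ∈ Λ ↔ ∃ ζ, IsOrd ρ α (jE ϖ ^ j) ζ ∧ x = x₀' * ζ) ∧
      IsOrd ρ α (jE ϖ ^ j) (dualGen ρ Θ α (jE ϖ ^ j) hM x₀') ∧ ¬ IsOrd ρ α (jE ϖ ^ j) (dualGen ρ Θ α (jE ϖ ^ j) hM x₀' / jE ϖ) ∧
      Valued.v (dualGen ρ Θ α (jE ϖ ^ j) hM x₀') = Valued.v (jE ϖ) ^ b) :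
    (∃ e : M, ρ e = e ∧ e * Θ e = hM * (x₀ * Θ x₀) + ρ (hM * (x₀ * Θ x₀))) ↔
      (∃ e : M, ρ e = e ∧ e * Θ e = hM * (x₀' * Θ x₀') + ρ (hM * (x₀' * Θ x₀'))) := by
  -- letters
  have hϖ : Valued.v ϖ = exp (-1 : ℤ) := hD.2.2.1
  have hϖ0 : ϖ ≠ 0 := fun h0 => by rw [h0, map_zero] at hϖ; exact exp_ne_zero hϖ.symm
  have hρj : ∀ c : E, ρ (jE c) = jE c := fun c => (hjfix _).2 ⟨c, rfl⟩
  have hjϖ0 : jE ϖ ≠ 0 := (map_ne_zero jE).2 hϖ0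
  have hjϖ1 : Valued.v (jE ϖ) ≤ 1 := (hjv ϖ).2 (by rw [hϖ, ← exp_zero, exp_le_exp]; norm_num)
  have hjϖlt : Valued.v (jE ϖ) < 1 := by
    by_contra hge
    have hge' : 1 ≤ Valued.v (jE ϖ) := not_lt.1 hge
    have hinv' : Valued.v ϖ⁻¹ ≤ 1 := (hjv _).1 (by rw [map_inv₀, map_inv₀]; exact (inv_le_one₀ (zero_lt_one.trans_le hge')).2 hge')
    rw [map_inv₀, hϖ, ← exp_neg, ← exp_zero, exp_le_exp] at hinv'
    norm_num at hinv'
  set cc : M := jE ϖ ^ j with hccdef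
  set A : M := α - ρ α with hAdef
  have hρcc : ρ cc = cc := by rw [hccdef, map_pow, hρj]
  have hΘcc : ρ (Θ cc) = Θ cc := by rw [← hΘρ, hρcc]
  have hccv : Valued.v cc = Valued.v (jE ϖ) ^ j := by rw [hccdef, Valuation.map_pow]
  have hcc1 : Valued.v cc ≤ 1 := by rw [hccv]; exact pow_le_one₀ zero_le hjϖ1
  have hcclt : Valued.v cc < 1 := by rw [hccv]; exact pow_lt_one₀ zero_le hjϖlt (by omega)
  have hcc0 : cc ≠ 0 := fun h0 => hcc (by rw [h0, zero_mul])
  have hA0 : A ≠ 0 := sub_ne_zero.2 (Ne.symm hα)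
  have hρA : ρ A = -A := by rw [hAdef, map_sub, hρρ]; ring
  have hAv0 : (0 : ℤᵐ⁰) < Valued.v A := zero_lt_iff.2 ((Valuation.ne_zero_iff _).2 hA0)
  have hccb : Valued.v cc ≤ Valued.v (jE ϖ) ^ b := by rw [hccv]; exact pow_le_pow_right_of_le_one' hjϖ1 hbj
  -- the two generators
  obtain ⟨hx₀, hΛ, hyO, hyprim, hylev⟩ := hG
  obtain ⟨hx₀', hΛ', hyO', hyprim', hylev'⟩ := hG'
  obtain ⟨hρt, hΘt, ht1⟩ := trace_letters (α := α) hρρ hΘΘ hΘρ hΘh (hρj ϖ) hjϖ0 hjϖ1 hb1 hcc hFgap hyO hyprim hylev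
  obtain ⟨hρt', hΘt', ht'1⟩ := trace_letters (α := α) hρρ hΘΘ hΘρ hΘh (hρj ϖ) hjϖ0 hjϖ1 hb1 hcc hFgap hyO' hyprim' hylev'
  set u₀ : M := hM * (x₀ * Θ x₀) with hu₀def
  set t : M := u₀ + ρ u₀ with htdef
  set t' : M := hM * (x₀' * Θ x₀') + ρ (hM * (x₀' * Θ x₀')) with ht'def
  have ht0 : t ≠ 0 := fun h0 => by rw [h0, map_zero] at ht1; exact zero_ne_one ht1
  have ht'0 : t' ≠ 0 := fun h0 => by rw [h0, map_zero] at ht'1; exact zero_ne_one ht'1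
  have hΘu : Θ u₀ = u₀ := by rw [hu₀def, map_mul, map_mul, hΘh, hΘΘ]; ring
  have hY : dualGen ρ Θ α (jE ϖ ^ j) hM x₀ = u₀ * (cc * A) := by rw [dualGen_def]
  set Y : M := dualGen ρ Θ α (jE ϖ ^ j) hM x₀ with hYdef
  have hYρ : Valued.v (Y - ρ Y) ≤ Valued.v (cc * A) := hyO.2
  have hu₀Y : u₀ = Y / (cc * A) := by rw [hY, mul_div_cancel_right₀ _ (mul_ne_zero hcc0 hA0)]
  -- `x₀′ = x₀·z`, `z` a unit of the order, `z = a + cc·y`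
  obtain ⟨z, z', hz, hz', hx₀z, hzz'⟩ := exists_isOrd_mul_of_presentations hx₀ hΛ hΛ'
  have hz1 : Valued.v z = 1 := v_eq_one_of_isOrd_of_mul_eq_one hz hz' hzz'
  obtain ⟨a, y, hρa, ha1, hy1, hzay⟩ := (mem_order_iff_exists hρρ hα hα1 hint hρcc hcc0 hcc1 z).1 hz
  have ha : Valued.v a = 1 := by
    have e : a = z + -(cc * y) := by rw [hzay]; ring
    have hlt : Valued.v (-(cc * y)) < Valued.v z := by
      rw [Valuation.map_neg, hz1, Valuation.map_mul]
      exact lt_of_le_of_lt (mul_le_of_le_one_right zero_le hy1) hcclt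
    rw [e, Valuation.map_add_eq_of_lt_left _ hlt, hz1]
  have ha0 : a ≠ 0 := fun h0 => by rw [h0, map_zero] at ha; exact zero_ne_one ha
  have haa1 : Valued.v (a * Θ a) = 1 := by rw [Valuation.map_mul, hvΘ, ha, mul_one]
  have haa0 : a * Θ a ≠ 0 := fun h0 => by rw [h0, map_zero] at haa1; exact zero_ne_one haa1
  have hρΘa : ρ (Θ a) = Θ a := by rw [← hΘρ, hρa]
  have hρaa : ρ (a * Θ a) = a * Θ a := by rw [map_mul, hρa, hρΘa]
  have hΘaa : Θ (a * Θ a) = a * Θ a := by rw [map_mul, hΘΘ, mul_comm]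
  -- `t′ = aΘa·t + (e₁ + Θe₁) + T₂`
  set w : M := cc * y with hwdef
  set e₁ : M := u₀ * Θ a * w + ρ (u₀ * Θ a * w) with he₁def
  set T₂ : M := u₀ * (w * Θ w) + ρ (u₀ * (w * Θ w)) with hT₂def
  have ht'dec : t' = a * Θ a * t + (e₁ + Θ e₁) + T₂ := by
    rw [ht'def, hx₀z, normTheta_gen_mul, ← hu₀def, hzay]
    exact trace_normTheta_add_decomp hΘΘ hΘρ hΘu hρa
  -- SIZE of `e₁`: `e₁ = Tr_ρ(X∕A)`, `X = Y·(Θa·y)`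
  have he₁X : e₁ = (Y * (Θ a * y) - ρ (Y * (Θ a * y))) / A := by
    rw [← div_add_map_div_of_anti hρA, he₁def, hu₀Y, hwdef]
    field_simp
  have hyρ : Valued.v (y - ρ y) ≤ Valued.v A := by have h1 := hint y hy1; rwa [map_div₀, div_le_one₀ hAv0] at h1
  have he₁v : Valued.v e₁ ≤ Valued.v (jE ϖ) ^ b := by
    rw [he₁X, map_div₀, div_le_iff₀ hAv0]
    refine v_sub_map_mul_le hvρ Y (Θ a * y) ?_ ?_
    · calc Valued.v (Y - ρ Y) * Valued.v (Θ a * y) ≤ Valued.v (cc * A) * 1 := by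
            refine mul_le_mul' hYρ ?_
            rw [Valuation.map_mul, hvΘ, ha, one_mul]; exact hy1
        _ = Valued.v cc * Valued.v A := by rw [mul_one, Valuation.map_mul]
        _ ≤ Valued.v (jE ϖ) ^ b * Valued.v A := mul_le_mul' hccb le_rfl
    · have e2 : Θ a * y - ρ (Θ a * y) = Θ a * (y - ρ y) := by rw [map_mul, hρΘa]; ring
      rw [e2, Valuation.map_mul, hvΘ, ha, one_mul, hylev]
      exact mul_le_mul' le_rfl hyρ
  -- SIZE of `T₂`: `T₂ = Tr_ρ(X₂∕A)`, `X₂ = Y·(y·Θ(cc·y))`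
  have hT₂X : T₂ = (Y * (y * Θ (cc * y)) - ρ (Y * (y * Θ (cc * y)))) / A := by
    rw [← div_add_map_div_of_anti hρA, hT₂def, hu₀Y, hwdef]
    field_simp
  have hT₂v : Valued.v T₂ ≤ Valued.v (jE ϖ) ^ (2 * d) := by
    have hmain : Valued.v T₂ ≤ Valued.v cc * Valued.v (jE ϖ) ^ b := by
      rw [hT₂X, map_div₀, div_le_iff₀ hAv0]
      refine v_sub_map_mul_le hvρ Y (y * Θ (cc * y)) ?_ ?_
      · calc Valued.v (Y - ρ Y) * Valued.v (y * Θ (cc * y)) ≤ Valued.v (cc * A) * Valued.v cc := by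
              refine mul_le_mul' hYρ ?_
              rw [Valuation.map_mul, hvΘ, Valuation.map_mul]
              calc Valued.v y * (Valued.v cc * Valued.v y) ≤ 1 * (Valued.v cc * 1) := by gcongr
                _ = Valued.v cc := by rw [one_mul, mul_one]
          _ = Valued.v cc * Valued.v cc * Valued.v A := by rw [Valuation.map_mul]; ac_rfl
          _ ≤ Valued.v cc * Valued.v (jE ϖ) ^ b * Valued.v A := by gcongr
      · have e2 : y * Θ (cc * y) - ρ (y * Θ (cc * y)) = Θ cc * (y * Θ y - ρ (y * Θ y)) := by
          rw [map_mul Θ, map_mul ρ, map_mul ρ, hΘcc, map_mul ρ]; ring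
        rw [e2, Valuation.map_mul, hvΘ, hylev]
        calc Valued.v (jE ϖ) ^ b * (Valued.v cc * Valued.v (y * Θ y - ρ (y * Θ y)))
            ≤ Valued.v (jE ϖ) ^ b * (Valued.v cc * (Valued.v (y - ρ y) * Valued.v y)) := by
              gcongr; exact v_normTheta_sub_map_le hvρ hΘρ hvΘ y
          _ ≤ Valued.v (jE ϖ) ^ b * (Valued.v cc * (Valued.v A * 1)) := by gcongr
          _ = Valued.v cc * Valued.v (jE ϖ) ^ b * Valued.v A := by rw [mul_one]; ac_rfl
    refine hmain.trans ?_
    calc Valued.v cc * Valued.v (jE ϖ) ^ b ≤ Valued.v (jE ϖ) ^ b * Valued.v (jE ϖ) ^ b := mul_le_mul' hccb le_rfl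
      _ = Valued.v (jE ϖ) ^ (b + b) := (pow_add _ _ _).symm
      _ ≤ Valued.v (jE ϖ) ^ (2 * d) := pow_le_pow_right_of_le_one' hjϖ1 (by omega)
  -- the trace gain on `e₁ ∈ Fix ρ`
  have hρe₁ : ρ e₁ = e₁ := by rw [he₁def, map_add, hρρ, add_comm]
  have hcross : Valued.v (e₁ + Θ e₁) ≤ Valued.v (jE ϖ) ^ (2 * d) := v_add_map_le_pow_two_mul_of_fixed hD jE hjv hjfix hΘj hdb hρe₁ he₁v
  -- `u = t′∕(aΘa·t)` is a deep doubly-fixed unit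
  set n : M := a * Θ a * t with hndef
  have hn0 : n ≠ 0 := mul_ne_zero haa0 ht0
  have hn1 : Valued.v n = 1 := by rw [hndef, Valuation.map_mul, haa1, ht1, one_mul]
  have hρn : ρ n = n := by rw [hndef, map_mul, hρaa, hρt]
  have hΘn : Θ n = n := by rw [hndef, map_mul, hΘaa, hΘt]
  set uu : M := t' / n with huudef
  have hρuu : ρ uu = uu := by rw [huudef, map_div₀, hρt', hρn]
  have hΘuu : Θ uu = uu := by rw [huudef, map_div₀, hΘt', hΘn]
  have huu1 : Valued.v (uu - 1) ≤ Valued.v (jE ϖ) ^ (2 * d) := by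
    have e1 : uu - 1 = ((e₁ + Θ e₁) + T₂) / n := by
      rw [huudef, div_sub_one hn0, ht'dec, hndef]; ring
    rw [e1, map_div₀, hn1, div_one]
    exact (Valuation.map_add _ _ _).trans (max_le hcross hT₂v)
  obtain ⟨c₀, hρc₀, hc₀⟩ := hdeep uu hρuu hΘuu huu1
  have hc₀0 : c₀ ≠ 0 := fun h0 => by
    have h1 : uu = 0 := by rw [← hc₀, h0, zero_mul]
    exact (div_ne_zero ht'0 hn0) (by rwa [huudef] at h1)
  -- `t′ = t·N_Θ(a·c₀)`
  have ht't : t' = t * ((a * c₀) * Θ (a * c₀)) := by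
    have e1 : t' = n * uu := by rw [huudef, mul_div_cancel₀ _ hn0]
    rw [e1, ← hc₀, hndef, map_mul]; ring
  exact exists_fixed_normTheta_iff_of_eq_mul (by rw [map_mul, hρa, hρc₀]) (mul_ne_zero ha0 hc₀0) ht't

/-! ## §5 THE DIGIT PART of (hI): the coordinate moves below `|jEϖ|^b` -/
omit [Valued E ℤᵐ⁰] in
/-- **(hI), DIGIT PART — «THE COORDINATE OF `κ̂` MOVES BELOW THE CELL'S DIGIT».**  Frame as in §4 without the datum ∕ `hdeep` (only `ρ(jEϖ) = jEϖ`-type letters through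
`hjfix`, `jEϖ ≠ 0`, `|jEϖ| ≤ 1`), plus the reference pair of ★ p863914 §1 (`κ₀`, `ξ₀ ≠ 0`) with its radius letter `hR : |jEϖ|^b ≤ |ξ₀|·|cc(α − ρα)|`.  THEN for two generators
`x₀, x₀′` of one `Λ` with the five `GEN` clauses: `|Vf x₀′ − Vf x₀| ≤ |jEϖ|^b`, `Vf x = (ρ(h·xΘx)∕(h·xΘx + ρ(h·xΘx)) − κ₀)∕ξ₀` (★ `div_trace_mul_sub_div_trace` at `w = ρu₀`,
`u = ρ(zΘz)`: `|κ̂′ − κ̂| = |u₀|²·|zΘz − ρ(zΘz)| ≤ |u₀|²·|cc(α − ρα)| ≤ |Y|·|ξ₀|`). [cite: Serre1979, Ch. III §6 Prop. 12] [cite: Jacobowitz1962, §4] [cite: Kottwitz1986BaseChangeUnits, §1 pp. 240–241] -/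
theorem v_coord_sub_coord_le_of_gen
    (jE : E →+* M) (hjfix : ∀ z, ρ z = z ↔ ∃ c, jE c = z) {ϖ : E} (hjϖ0 : jE ϖ ≠ 0) (hjϖ1 : Valued.v (jE ϖ) ≤ 1)
    (hρρ : ∀ x, ρ (ρ x) = x) (hvρ : ∀ x, Valued.v (ρ x) = Valued.v x) (hΘΘ : ∀ x, Θ (Θ x) = x) (hΘρ : ∀ x, Θ (ρ x) = ρ (Θ x))
    (hvΘ : ∀ x, Valued.v (Θ x) = Valued.v x)
    {hM : M} (hΘh : Θ hM = hM) {j b : ℕ} (hb1 : 1 ≤ b) (hcc : jE ϖ ^ j * (α - ρ α) ≠ 0)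
    (hFgap : ∀ z : M, ρ z = z → Θ z = z → Valued.v (jE ϖ) < Valued.v z → Valued.v z ≤ 1 → Valued.v z = 1)
    (κ₀ : M) {ξ₀ : M} (hξ0 : ξ₀ ≠ 0) (hR : Valued.v (jE ϖ) ^ b ≤ Valued.v ξ₀ * Valued.v (jE ϖ ^ j * (α - ρ α)))
    (Λ : AddSubgroup M) (x₀ x₀' : M)
    (hG : x₀ ≠ 0 ∧ (∀ x, x ∈ Λ ↔ ∃ ζ, IsOrd ρ α (jE ϖ ^ j) ζ ∧ x = x₀ * ζ) ∧
      IsOrd ρ α (jE ϖ ^ j) (dualGen ρ Θ α (jE ϖ ^ j) hM x₀) ∧ ¬ IsOrd ρ α (jE ϖ ^ j) (dualGen ρ Θ α (jE ϖ ^ j) hM x₀ / jE ϖ) ∧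
      Valued.v (dualGen ρ Θ α (jE ϖ ^ j) hM x₀) = Valued.v (jE ϖ) ^ b)
    (hG' : x₀' ≠ 0 ∧ (∀ x, x ∈ Λ ↔ ∃ ζ, IsOrd ρ α (jE ϖ ^ j) ζ ∧ x = x₀' * ζ) ∧
      IsOrd ρ α (jE ϖ ^ j) (dualGen ρ Θ α (jE ϖ ^ j) hM x₀') ∧ ¬ IsOrd ρ α (jE ϖ ^ j) (dualGen ρ Θ α (jE ϖ ^ j) hM x₀' / jE ϖ) ∧
      Valued.v (dualGen ρ Θ α (jE ϖ ^ j) hM x₀') = Valued.v (jE ϖ) ^ b) :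
    Valued.v ((ρ (hM * (x₀' * Θ x₀')) / (hM * (x₀' * Θ x₀') + ρ (hM * (x₀' * Θ x₀'))) - κ₀) / ξ₀ -
        (ρ (hM * (x₀ * Θ x₀)) / (hM * (x₀ * Θ x₀) + ρ (hM * (x₀ * Θ x₀))) - κ₀) / ξ₀) ≤ Valued.v (jE ϖ) ^ b := by
  have hρj : ∀ c : E, ρ (jE c) = jE c := fun c => (hjfix _).2 ⟨c, rfl⟩
  have hccAv : (0 : ℤᵐ⁰) < Valued.v (jE ϖ ^ j * (α - ρ α)) := zero_lt_iff.2 ((Valuation.ne_zero_iff _).2 hcc)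
  have hξv : (0 : ℤᵐ⁰) < Valued.v ξ₀ := zero_lt_iff.2 ((Valuation.ne_zero_iff _).2 hξ0)
  obtain ⟨hx₀, hΛ, hyO, hyprim, hylev⟩ := hG
  obtain ⟨hx₀', hΛ', hyO', hyprim', hylev'⟩ := hG'
  obtain ⟨-, -, ht1⟩ := trace_letters (α := α) hρρ hΘΘ hΘρ hΘh (hρj ϖ) hjϖ0 hjϖ1 hb1 hcc hFgap hyO hyprim hylev
  obtain ⟨-, -, ht'1⟩ := trace_letters (α := α) hρρ hΘΘ hΘρ hΘh (hρj ϖ) hjϖ0 hjϖ1 hb1 hcc hFgap hyO' hyprim' hylev'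
  have hu₀v : Valued.v (hM * (x₀ * Θ x₀)) * Valued.v (jE ϖ ^ j * (α - ρ α)) = Valued.v (jE ϖ) ^ b := by
    rw [← Valuation.map_mul, ← dualGen_def, hylev]
  -- `x₀′ = x₀·z`, `u₀′ = u₀·N`, `N = zΘz`
  obtain ⟨z, z', hz, hz', hx₀z, hzz'⟩ := exists_isOrd_mul_of_presentations hx₀ hΛ hΛ'
  have hz1 : Valued.v z = 1 := v_eq_one_of_isOrd_of_mul_eq_one hz hz' hzz'
  have hu₀' : hM * (x₀' * Θ x₀') = hM * (x₀ * Θ x₀) * (z * Θ z) := by rw [hx₀z, normTheta_gen_mul]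
  rw [hu₀'] at ht'1 ⊢
  set u₀ : M := hM * (x₀ * Θ x₀) with hu₀def
  set N : M := z * Θ z with hNdef
  have ht0 : u₀ + ρ u₀ ≠ 0 := fun h0 => by rw [h0, map_zero] at ht1; exact zero_ne_one ht1
  have ht'0 : u₀ * N + ρ (u₀ * N) ≠ 0 := fun h0 => by rw [h0, map_zero] at ht'1; exact zero_ne_one ht'1
  -- the exact change of the digit and its size
  have e0 : (ρ (u₀ * N) / (u₀ * N + ρ (u₀ * N)) - κ₀) / ξ₀ - (ρ u₀ / (u₀ + ρ u₀) - κ₀) / ξ₀ =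
      (ρ (u₀ * N) / (u₀ * N + ρ (u₀ * N)) - ρ u₀ / (u₀ + ρ u₀)) / ξ₀ := by ring
  rw [e0, digit_mul_sub_digit hρρ ht0 ht'0, map_div₀, div_le_iff₀ hξv]
  simp only [map_div₀, Valuation.map_mul, hvρ, ht1, ht'1, mul_one, div_one]
  have hskew : Valued.v (ρ N - N) ≤ Valued.v (jE ϖ ^ j * (α - ρ α)) := by
    rw [← Valuation.map_neg, neg_sub, hNdef]
    exact (v_normTheta_sub_map_le hvρ hΘρ hvΘ z).trans (by rw [hz1, mul_one]; exact hz.2)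
  have hu₀le : Valued.v u₀ ≤ Valued.v ξ₀ := by
    refine le_of_mul_le_mul_right ?_ hccAv
    rw [hu₀v]; exact hR
  calc Valued.v u₀ * Valued.v u₀ * Valued.v (ρ N - N) ≤ Valued.v ξ₀ * Valued.v u₀ * Valued.v (jE ϖ ^ j * (α - ρ α)) := by gcongr
    _ = Valued.v (jE ϖ) ^ b * Valued.v ξ₀ := by rw [mul_assoc, hu₀v, mul_comm]

/-! ## §6 HEAD — the (hI) hypothesis of ★ p863833 in the ROW currency -/
/-- **HEAD — THE (hI) LETTER OF ★ `…ConeCellCountSocketThree.cellDiff_eq_zero_of_fibration_reads₃` AT ★ p863914's `CLS ∕ Vf`.**  Frame of §4 + the reference-pair letters of §5 and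
any socket radius `r` with `|jEϖ|^b ≤ r`.  THEN for all `Λ x₀ x₀′` with the five `GEN` clauses at `x₀` and at `x₀′`:
`(CLS x₀ ↔ CLS x₀′) ∧ |Vf x₀′ − Vf x₀| ≤ r` — the socket's `hI` is `fun Λ x₀ x₀' hG hG' => cls_iff_cls_and_v_sub_le_of_gen … r hr Λ x₀ x₀' hG hG'`.
[cite: Serre1979, Ch. III §6 Prop. 12; Ch. V §3 Cor. 3] [cite: Kottwitz1986BaseChangeUnits, §1 pp. 240–241] [cite: Jacobowitz1962, §4] -/
theorem cls_iff_cls_and_v_sub_le_of_gen {σ : E →+* E} {ϖ : E} {d tE : ℕ} (hD : IsRamifiedQuadraticDatum σ ϖ d tE)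
    (jE : E →+* M) (hjv : ∀ c, Valued.v (jE c) ≤ 1 ↔ Valued.v c ≤ 1) (hjfix : ∀ z, ρ z = z ↔ ∃ c, jE c = z) (hΘj : ∀ c, Θ (jE c) = jE (σ c))
    (hρρ : ∀ x, ρ (ρ x) = x) (hvρ : ∀ x, Valued.v (ρ x) = Valued.v x) (hΘΘ : ∀ x, Θ (Θ x) = x) (hΘρ : ∀ x, Θ (ρ x) = ρ (Θ x))
    (hvΘ : ∀ x, Valued.v (Θ x) = Valued.v x)
    (hα : ρ α ≠ α) (hα1 : Valued.v α ≤ 1) (hint : ∀ z : M, Valued.v z ≤ 1 → Valued.v ((z - ρ z) / (α - ρ α)) ≤ 1)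
    {hM : M} (hΘh : Θ hM = hM) {j b : ℕ} (hb1 : 1 ≤ b) (hdb : d ≤ b) (hbj : b ≤ j) (hcc : jE ϖ ^ j * (α - ρ α) ≠ 0)
    (hFgap : ∀ z : M, ρ z = z → Θ z = z → Valued.v (jE ϖ) < Valued.v z → Valued.v z ≤ 1 → Valued.v z = 1)
    (hdeep : ∀ u : M, ρ u = u → Θ u = u → Valued.v (u - 1) ≤ Valued.v (jE ϖ) ^ (2 * d) → ∃ c : M, ρ c = c ∧ c * Θ c = u)
    (κ₀ : M) {ξ₀ : M} (hξ0 : ξ₀ ≠ 0) (hR : Valued.v (jE ϖ) ^ b ≤ Valued.v ξ₀ * Valued.v (jE ϖ ^ j * (α - ρ α)))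
    (r : ℤᵐ⁰) (hr : Valued.v (jE ϖ) ^ b ≤ r)
    (Λ : AddSubgroup M) (x₀ x₀' : M)
    (hG : x₀ ≠ 0 ∧ (∀ x, x ∈ Λ ↔ ∃ ζ, IsOrd ρ α (jE ϖ ^ j) ζ ∧ x = x₀ * ζ) ∧
      IsOrd ρ α (jE ϖ ^ j) (dualGen ρ Θ α (jE ϖ ^ j) hM x₀) ∧ ¬ IsOrd ρ α (jE ϖ ^ j) (dualGen ρ Θ α (jE ϖ ^ j) hM x₀ / jE ϖ) ∧
      Valued.v (dualGen ρ Θ α (jE ϖ ^ j) hM x₀) = Valued.v (jE ϖ) ^ b)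
    (hG' : x₀' ≠ 0 ∧ (∀ x, x ∈ Λ ↔ ∃ ζ, IsOrd ρ α (jE ϖ ^ j) ζ ∧ x = x₀' * ζ) ∧
      IsOrd ρ α (jE ϖ ^ j) (dualGen ρ Θ α (jE ϖ ^ j) hM x₀') ∧ ¬ IsOrd ρ α (jE ϖ ^ j) (dualGen ρ Θ α (jE ϖ ^ j) hM x₀' / jE ϖ) ∧
      Valued.v (dualGen ρ Θ α (jE ϖ ^ j) hM x₀') = Valued.v (jE ϖ) ^ b) :
    ((∃ e : M, ρ e = e ∧ e * Θ e = hM * (x₀ * Θ x₀) + ρ (hM * (x₀ * Θ x₀))) ↔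
        (∃ e : M, ρ e = e ∧ e * Θ e = hM * (x₀' * Θ x₀') + ρ (hM * (x₀' * Θ x₀')))) ∧
      Valued.v ((ρ (hM * (x₀' * Θ x₀')) / (hM * (x₀' * Θ x₀') + ρ (hM * (x₀' * Θ x₀'))) - κ₀) / ξ₀ -
        (ρ (hM * (x₀ * Θ x₀)) / (hM * (x₀ * Θ x₀) + ρ (hM * (x₀ * Θ x₀))) - κ₀) / ξ₀) ≤ r := by
  have hϖ : Valued.v ϖ = exp (-1 : ℤ) := hD.2.2.1
  have hvϖ0 : Valued.v ϖ ≠ 0 := by rw [hϖ]; exact exp_ne_zero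
  have hϖ0 : ϖ ≠ 0 := fun h0 => by rw [h0, map_zero] at hvϖ0; exact hvϖ0 rfl
  have hϖ1 : Valued.v ϖ ≤ 1 := by rw [hϖ, ← exp_zero, exp_le_exp]; norm_num
  have hjϖ0 : jE ϖ ≠ 0 := (map_ne_zero jE).2 hϖ0
  have hjϖ1 : Valued.v (jE ϖ) ≤ 1 := (hjv ϖ).2 hϖ1
  exact ⟨cls_iff_cls_of_gen hD jE hjv hjfix hΘj hρρ hvρ hΘΘ hΘρ hvΘ hα hα1 hint hΘh hb1 hdb hbj hcc hFgap hdeep Λ x₀ x₀' hG hG',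
    (v_coord_sub_coord_le_of_gen jE hjfix hjϖ0 hjϖ1 hρρ hvρ hΘΘ hΘρ hvΘ hΘh hb1 hcc hFgap κ₀ hξ0 hR Λ x₀ x₀' hG hG').trans hr⟩

end Summit.HodgeConjecture.HodgeConjecture.Cruxes.H413.F0P3cDyRamRowCellGeneratorIndependence

end
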